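import Summits.QuantumAdvantage.QuantumAdvantage.Theorems.LinnikCubicClassGroupsDegreeOnePrimesEscapeQuinticS5Group32
import Mathlib.GroupTheory.Perm.Sign
import HarnessLib

/-!
# The `A₅`-dictionary for 5-cycles as a one-sided inequality of permutation characters

Topic `Summits/QuantumAdvantage/QuantumAdvantage/Theorems`, cell B2b-1 (linnik-cubic), PART A (gen 8);
helper toward the crux `DegreeOnePrimesEscape` (stmt-QuantumAdvantage-11543) of route
`LinnikCubicClassGroups`.  HONEST FRAMING: the value of this file is a THEOREM (kernel-checked finite
group theory) — NOT summit progress.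

In `A₅` let `V = {1, (12)(34), (13)(24), (14)(23)}` (fixing `0`) and `A = Stab_{A₅}(0) ≅ A₄`.  The class
function `1 − Ind_V^{A₅}1/6 − Ind_A^{A₅}1/2` vanishes on `1`, the double transpositions and the 3-cycles and
equals `1` on the 5-cycles (mean `1/3`; found by a small LP).  In the normal form used downstream, with
the `A₅`-conjugation counts expressed through `S₅`-counts (they are halves of them, `V` and `Stab(0)`
being normalised by the odd permutation `(1 2)`):

  `48 ≤ #{q ∈ S₅ : q y q⁻¹ ∈ V} + #{q ∈ S₅ : (q y q⁻¹)(0) = 0} + 48·𝟙[Fix(y) = ∅]`  for EVEN `y`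

(`quinticA5_pointwise`), together with the bookkeeping needed to pull the data back along an injective
`ψ : G →* S₅` with image `A₅` (`natCard_conj_eq_card_filter_even`, `card_filter_even_mul_two`).
-/

noncomputable section

open Equiv Equiv.Perm

namespace Summit.QuantumAdvantage.QuantumAdvantage.Theorems.DegreeOnePrimesEscape

/-! ### Halving: even versus all conjugators -/

/-- If a test `Q` on `S_n` is invariant under left multiplication by an ODD permutation `u`, then the
even permutations passing it are exactly half: `2 · #{q even : Q q} = #{q : Q q}`. -/
theorem card_filter_even_mul_two {n : ℕ} (Q : Perm (Fin n) → Prop) [DecidablePred Q]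
    (u : Perm (Fin n)) (hu : Perm.sign u = -1) (hQ : ∀ q, Q (u * q) ↔ Q q) :
    2 * (Finset.univ.filter fun q : Perm (Fin n) => Perm.sign q = 1 ∧ Q q).card =
      (Finset.univ.filter Q).card := by
  classical
  have hsplit := Finset.card_filter_add_card_filter_not
    (s := Finset.univ.filter Q) (fun q : Perm (Fin n) => Perm.sign q = 1)
  rw [Finset.filter_filter, Finset.filter_filter] at hsplit
  have hcomm1 : (Finset.univ.filter fun q : Perm (Fin n) => Q q ∧ Perm.sign q = 1) =
      Finset.univ.filter fun q : Perm (Fin n) => Perm.sign q = 1 ∧ Q q :=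
    Finset.filter_congr fun q _ => and_comm
  -- the odd ones are in bijection with the even ones via `q ↦ u * q`
  have hbij : (Finset.univ.filter fun q : Perm (Fin n) => Q q ∧ ¬ Perm.sign q = 1).card =
      (Finset.univ.filter fun q : Perm (Fin n) => Perm.sign q = 1 ∧ Q q).card := by
    refine Finset.card_bij (fun q _ => u * q) ?_ ?_ ?_
    · intro q hq
      rw [Finset.mem_filter] at hq ⊢
      refine ⟨Finset.mem_univ _, ?_, (hQ q).mpr hq.2.1⟩
      rw [Perm.sign_mul, hu]
      rcases Int.units_eq_one_or (Perm.sign q) with h | h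
      · exact absurd h hq.2.2
      · rw [h]; decide
    · intro q₁ _ q₂ _ h
      exact mul_left_cancel h
    · intro q hq
      rw [Finset.mem_filter] at hq
      refine ⟨u⁻¹ * q, ?_, by rw [← mul_assoc, mul_inv_cancel, one_mul]⟩
      rw [Finset.mem_filter]
      refine ⟨Finset.mem_univ _, ?_, ?_⟩
      · have := (hQ (u⁻¹ * q)).mp (by rw [← mul_assoc, mul_inv_cancel, one_mul]; exact hq.2.2)
        exact this
      · rw [Perm.sign_mul, Perm.sign_inv, hu, hq.2.1]; decide
  rw [hcomm1, hbij] at hsplit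
  omega

/-! ### Pulling counts back along an injective `ψ : G →* S_n` with image the even permutations -/

section Pullback

variable {n : ℕ} {G : Type*} [Group G] (ψ : G →* Perm (Fin n)) (hinj : Function.Injective ψ)
  (hrange : ∀ q : Perm (Fin n), q ∈ ψ.range ↔ Perm.sign q = 1)
include hinj hrange

/-- Conjugation counts in `G` are counts over EVEN permutations. -/
theorem natCard_conj_eq_card_filter_even (H : Subgroup G) (P : Perm (Fin n) → Prop)
    [DecidablePred P] (hH : ∀ g, g ∈ H ↔ P (ψ g)) (x : G) :
    Nat.card {g : G // g * x * g⁻¹ ∈ H} =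
      (Finset.univ.filter fun q : Perm (Fin n) => Perm.sign q = 1 ∧ P (q * ψ x * q⁻¹)).card := by
  classical
  have hsurj : ∀ q : Perm (Fin n), Perm.sign q = 1 → ∃ g, ψ g = q := fun q hq =>
    (hrange q).mpr hq
  let F : {g : G // g * x * g⁻¹ ∈ H} → {q : Perm (Fin n) // Perm.sign q = 1 ∧ P (q * ψ x * q⁻¹)} :=
    fun g => ⟨ψ g.1, (hrange _).mp ⟨g.1, rfl⟩, by
      have h := (hH _).mp g.2
      rwa [map_mul, map_mul, map_inv] at h⟩
  have hF : Function.Bijective F := by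
    constructor
    · intro a b h
      exact Subtype.ext (hinj (congrArg (fun q : {q : Perm (Fin n) // _} => q.1) h))
    · intro q
      obtain ⟨g, hg⟩ := hsurj q.1 q.2.1
      refine ⟨⟨g, ?_⟩, Subtype.ext hg⟩
      rw [hH, map_mul, map_mul, map_inv, hg]
      exact q.2.2
  rw [Nat.card_congr (Equiv.ofBijective F hF), Nat.card_eq_fintype_card, Fintype.card_subtype]

/-- Orders of subgroups of `G` are counts over EVEN permutations. -/
theorem natCard_subgroup_eq_card_filter_even (H : Subgroup G) (P : Perm (Fin n) → Prop)
    [DecidablePred P] (hH : ∀ g, g ∈ H ↔ P (ψ g)) :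
    Nat.card H = (Finset.univ.filter fun q : Perm (Fin n) => Perm.sign q = 1 ∧ P q).card := by
  classical
  have hsurj : ∀ q : Perm (Fin n), Perm.sign q = 1 → ∃ g, ψ g = q := fun q hq =>
    (hrange q).mpr hq
  let F : H → {q : Perm (Fin n) // Perm.sign q = 1 ∧ P q} :=
    fun g => ⟨ψ g.1, (hrange _).mp ⟨g.1, rfl⟩, (hH _).mp g.2⟩
  have hF : Function.Bijective F := by
    constructor
    · intro a b h
      exact Subtype.ext (hinj (congrArg (fun q : {q : Perm (Fin n) // _} => q.1) h))
    · intro q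
      obtain ⟨g, hg⟩ := hsurj q.1 q.2.1
      refine ⟨⟨g, ?_⟩, Subtype.ext hg⟩
      rw [hH, hg]
      exact q.2.2
  rw [Nat.card_congr (Equiv.ofBijective F hF), Nat.card_eq_fintype_card, Fintype.card_subtype]

end Pullback

/-! ### The computation in `S₅` -/

set_option maxRecDepth 8000 in
/-- The Klein four-group `V` on `{1,2,3,4}`: contains `1`, closed under products and inverses,
normalised by `(1 2)`; `#{q even : q ∈ V} = 4`, `#{q even : q 0 = 0} = 12`, `#{q : q 0 = 0} = 24`;
`(1 2)` is odd and fixes `0`. (`decide`) -/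
theorem kleinFour_facts :
    (1 : Perm (Fin 5)) ∈ ({1, Equiv.swap (1 : Fin 5) 2 * Equiv.swap (3 : Fin 5) 4, Equiv.swap (1 : Fin 5) 3 * Equiv.swap (2 : Fin 5) 4, Equiv.swap (1 : Fin 5) 4 * Equiv.swap (2 : Fin 5) 3} : Finset (Perm (Fin 5))) ∧
    (∀ a ∈ ({1, Equiv.swap (1 : Fin 5) 2 * Equiv.swap (3 : Fin 5) 4, Equiv.swap (1 : Fin 5) 3 * Equiv.swap (2 : Fin 5) 4, Equiv.swap (1 : Fin 5) 4 * Equiv.swap (2 : Fin 5) 3} : Finset (Perm (Fin 5))), ∀ b ∈ ({1, Equiv.swap (1 : Fin 5) 2 * Equiv.swap (3 : Fin 5) 4, Equiv.swap (1 : Fin 5) 3 * Equiv.swap (2 : Fin 5) 4, Equiv.swap (1 : Fin 5) 4 * Equiv.swap (2 : Fin 5) 3} : Finset (Perm (Fin 5))), a * b ∈ ({1, Equiv.swap (1 : Fin 5) 2 * Equiv.swap (3 : Fin 5) 4, Equiv.swap (1 : Fin 5) 3 * Equiv.swap (2 : Fin 5) 4, Equiv.swap (1 : Fin 5) 4 *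 Equiv.swap (2 : Fin 5) 3} : Finset (Perm (Fin 5)))) ∧
    (∀ a ∈ ({1, Equiv.swap (1 : Fin 5) 2 * Equiv.swap (3 : Fin 5) 4, Equiv.swap (1 : Fin 5) 3 * Equiv.swap (2 : Fin 5) 4, Equiv.swap (1 : Fin 5) 4 * Equiv.swap (2 : Fin 5) 3} : Finset (Perm (Fin 5))), a⁻¹ ∈ ({1, Equiv.swap (1 : Fin 5) 2 * Equiv.swap (3 : Fin 5) 4, Equiv.swap (1 : Fin 5) 3 * Equiv.swap (2 : Fin 5) 4, Equiv.swap (1 : Fin 5) 4 * Equiv.swap (2 : Fin 5) 3} : Finset (Perm (Fin 5)))) ∧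
    (∀ v : Perm (Fin 5), Equiv.swap (1 : Fin 5) 2 * v * (Equiv.swap (1 : Fin 5) 2)⁻¹ ∈ ({1, Equiv.swap (1 : Fin 5) 2 * Equiv.swap (3 : Fin 5) 4, Equiv.swap (1 : Fin 5) 3 * Equiv.swap (2 : Fin 5) 4, Equiv.swap (1 : Fin 5) 4 * Equiv.swap (2 : Fin 5) 3} : Finset (Perm (Fin 5))) ↔ v ∈ ({1, Equiv.swap (1 : Fin 5) 2 * Equiv.swap (3 : Fin 5) 4, Equiv.swap (1 : Fin 5) 3 * Equiv.swap (2 : Fin 5) 4, Equiv.swap (1 : Fin 5) 4 * Equiv.swap (2 : Fin 5) 3} : Finset (Perm (Fin 5)))) ∧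
    (Finset.univ.filter fun q : Perm (Fin 5) => Perm.sign q = 1 ∧ q ∈ ({1, Equiv.swap (1 : Fin 5) 2 * Equiv.swap (3 : Fin 5) 4, Equiv.swap (1 : Fin 5) 3 * Equiv.swap (2 : Fin 5) 4, Equiv.swap (1 : Fin 5) 4 * Equiv.swap (2 : Fin 5) 3} : Finset (Perm (Fin 5)))).card = 4 ∧
    (Finset.univ.filter fun q : Perm (Fin 5) => Perm.sign q = 1 ∧ q 0 = 0).card = 12 ∧
    (Finset.univ.filter fun q : Perm (Fin 5) => q 0 = 0).card = 24 ∧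
    Perm.sign (Equiv.swap (1 : Fin 5) 2) = -1 ∧ (Equiv.swap (1 : Fin 5) 2) 0 = 0 := by
  refine ⟨by decide, by decide, by decide, by decide, by decide, by decide, by decide, by decide, by decide⟩

set_option maxRecDepth 8000 in
/-- Counts at the even representative `one`: into `V`, into `Stab(0)`, and fixed points. -/
private theorem countsA5_one :
    (Finset.univ.filter fun q : Perm (Fin 5) => q * (1 : Perm (Fin 5)) * q⁻¹ ∈ ({1, Equiv.swap (1 : Fin 5) 2 * Equiv.swap (3 : Fin 5) 4, Equiv.swap (1 : Fin 5) 3 * Equiv.swap (2 : Fin 5) 4, Equiv.swap (1 : Fin 5) 4 * Equiv.swap (2 : Fin 5) 3} : Finset (Perm (Fin 5)))).card = 120 ∧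
    (Finset.univ.filter fun q : Perm (Fin 5) => (q * (1 : Perm (Fin 5)) * q⁻¹) 0 = 0).card = 120 ∧
    (Finset.univ.filter fun i : Fin 5 => ((1 : Perm (Fin 5))) i = i).card = 5 := by
  refine ⟨by decide, by decide, by decide⟩

set_option maxRecDepth 8000 in
/-- Counts at the even representative `r22`: into `V`, into `Stab(0)`, and fixed points. -/
private theorem countsA5_r22 :
    (Finset.univ.filter fun q : Perm (Fin 5) => q * (Fin.cycleRange (1 : Fin 5) * Equiv.swap (3 : Fin 5) 4) * q⁻¹ ∈ ({1, Equiv.swap (1 : Fin 5) 2 * Equiv.swap (3 : Fin 5) 4, Equiv.swap (1 : Fin 5) 3 * Equiv.swap (2 : Fin 5) 4, Equiv.swap (1 : Fin 5) 4 * Equiv.swap (2 : Fin 5) 3} : Finset (Perm (Fin 5)))).card = 24 ∧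
    (Finset.univ.filter fun q : Perm (Fin 5) => (q * (Fin.cycleRange (1 : Fin 5) * Equiv.swap (3 : Fin 5) 4) * q⁻¹) 0 = 0).card = 24 ∧
    (Finset.univ.filter fun i : Fin 5 => ((Fin.cycleRange (1 : Fin 5) * Equiv.swap (3 : Fin 5) 4)) i = i).card = 1 := by
  refine ⟨by decide, by decide, by decide⟩

set_option maxRecDepth 8000 in
/-- Counts at the even representative `r3`: into `V`, into `Stab(0)`, and fixed points. -/
private theorem countsA5_r3 :
    (Finset.univ.filter fun q : Perm (Fin 5) => q * Fin.cycleRange (2 : Fin 5) * q⁻¹ ∈ ({1, Equiv.swap (1 : Fin 5) 2 * Equiv.swap (3 : Fin 5) 4, Equiv.swap (1 : Fin 5) 3 * Equiv.swap (2 : Fin 5) 4, Equiv.swap (1 : Fin 5) 4 * Equiv.swap (2 : Fin 5) 3} : Finset (Perm (Fin 5)))).card = 0 ∧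
    (Finset.univ.filter fun q : Perm (Fin 5) => (q * Fin.cycleRange (2 : Fin 5) * q⁻¹) 0 = 0).card = 48 ∧
    (Finset.univ.filter fun i : Fin 5 => (Fin.cycleRange (2 : Fin 5)) i = i).card = 2 := by
  refine ⟨by decide, by decide, by decide⟩

set_option maxRecDepth 8000 in
/-- Counts at the even representative `r5`: into `V`, into `Stab(0)`, and fixed points. -/
private theorem countsA5_r5 :
    (Finset.univ.filter fun q : Perm (Fin 5) => q * Fin.cycleRange (4 : Fin 5) * q⁻¹ ∈ ({1, Equiv.swap (1 : Fin 5) 2 * Equiv.swap (3 : Fin 5) 4, Equiv.swap (1 : Fin 5) 3 * Equiv.swap (2 : Fin 5) 4, Equiv.swap (1 : Fin 5) 4 * Equiv.swap (2 : Fin 5) 3} : Finset (Perm (Fin 5)))).card = 0 ∧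
    (Finset.univ.filter fun q : Perm (Fin 5) => (q * Fin.cycleRange (4 : Fin 5) * q⁻¹) 0 = 0).card = 0 ∧
    (Finset.univ.filter fun i : Fin 5 => (Fin.cycleRange (4 : Fin 5)) i = i).card = 0 := by
  refine ⟨by decide, by decide, by decide⟩

/-- The representative `r2` is odd. -/
private theorem signA5_r2 : Perm.sign (Fin.cycleRange (1 : Fin 5)) = -1 := by decide

/-- The representative `r4` is odd. -/
private theorem signA5_r4 : Perm.sign (Fin.cycleRange (3 : Fin 5)) = -1 := by decide

/-- The representative `r32` is odd. -/
private theorem signA5_r32 : Perm.sign ((Fin.cycleRange (2 : Fin 5) * Equiv.swap (3 : Fin 5) 4)) = -1 := by decide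

/-- **The one-sided `A₅`-inequality for 5-cycles, in `S₅`-counts**: for every EVEN `y ∈ S₅`,
`48 ≤ #{q : q y q⁻¹ ∈ V} + #{q : (q y q⁻¹)(0) = 0} + 48·𝟙[Fix(y) = ∅]`. -/
theorem quinticA5_pointwise (y : Perm (Fin 5)) (hy : Perm.sign y = 1) :
    48 ≤ (Finset.univ.filter fun q : Perm (Fin 5) => q * y * q⁻¹ ∈ ({1, Equiv.swap (1 : Fin 5) 2 * Equiv.swap (3 : Fin 5) 4, Equiv.swap (1 : Fin 5) 3 * Equiv.swap (2 : Fin 5) 4, Equiv.swap (1 : Fin 5) 4 * Equiv.swap (2 : Fin 5) 3} : Finset (Perm (Fin 5)))).card +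
      (Finset.univ.filter fun q : Perm (Fin 5) => (q * y * q⁻¹) 0 = 0).card +
      (if (Finset.univ.filter fun i : Fin 5 => y i = i).card = 0 then 48 else 0) := by
  classical
  obtain ⟨ρ, hρ, hconj⟩ := exists_rep_isConj y
  obtain ⟨c, hc⟩ := isConj_iff.mp hconj
  subst hc
  have hsign : Perm.sign ρ = 1 := by
    have h : Perm.sign (c * ρ * c⁻¹) = Perm.sign ρ := by
      rw [Perm.sign_mul, Perm.sign_mul, Perm.sign_inv, mul_right_comm, Int.units_mul_self, one_mul]
    rw [← h]; exact hy
  rw [card_filter_conj_mem_of_conj, card_filter_conj_of_conj (fun q : Perm (Fin 5) => q 0 = 0),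
    card_filter_fixed_of_conj]
  simp only [Finset.mem_insert, Finset.mem_singleton] at hρ
  rcases hρ with rfl | rfl | rfl | rfl | rfl | rfl | rfl
  · obtain ⟨e1, e2, e3⟩ := countsA5_one
    rw [e1, e2, e3]; norm_num
  · exact absurd hsign (by rw [signA5_r2]; decide)
  · obtain ⟨e1, e2, e3⟩ := countsA5_r3
    rw [e1, e2, e3]; norm_num
  · exact absurd hsign (by rw [signA5_r4]; decide)
  · obtain ⟨e1, e2, e3⟩ := countsA5_r5
    rw [e1, e2, e3]; norm_num
  · obtain ⟨e1, e2, e3⟩ := countsA5_r22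
    rw [e1, e2, e3]; norm_num
  · exact absurd hsign (by rw [signA5_r32]; decide)

set_option maxRecDepth 8000 in
/-- **An even permutation of `Fin 5` without fixed points is a 5-cycle**: its first four powers have
no fixed points either. (`decide`) -/
theorem fixedPoints_pow_of_even_derangement : ∀ y : Perm (Fin 5), Perm.sign y = 1 →
    (Finset.univ.filter fun i : Fin 5 => y i = i).card = 0 →
      (Finset.univ.filter fun i : Fin 5 => (y ^ 2) i = i).card = 0 ∧
      (Finset.univ.filter fun i : Fin 5 => (y ^ 3) i = i).card = 0 ∧
      (Finset.univ.filter fun i : Fin 5 => (y ^ 4) i = i).card = 0 := by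
  decide

end Summit.QuantumAdvantage.QuantumAdvantage.Theorems.DegreeOnePrimesEscape

end
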